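import Mathlib
import Literature.Computability.Complexity.ExtMonotoneGates
import Literature.Computability.Cryptography.HallgrenClassGroupGeneration
import Summits.PneNP.PneNP.Theorems.ConvexRankGatesLinAlgGateBlindDefs
import Summits.PneNP.PneNP.Theorems.ConvexRankGatesLinAlgGateBlindPlanting
import Summits.PneNP.PneNP.Theorems.ConvexRankGatesLinAlgGateBlindDenseRegime
import Summits.PneNP.PneNP.Theorems.ConvexRankGatesLinAlgGateBlindDenseRegimeAux
import Summits.PneNP.PneNP.Theorems.ConvexRankGatesLinAlgGateBlindPermSmallDimAux

/-!
# SG_PERM for permutation gates with few subgroups (corollary of the planting theorem; line `dnf-invariant-wide-gates-see-small-cliques`, crux `LinAlgGateBlind`, stmt-PneNP-10681, route ConvexRankGates)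

The research stub `stub_sgPerm` of the line asks for `SGAt m (IsPermGate (m^c)) (lOf m) (kOf m) (qOf m) (epsOf c m)`
eventually in `m`: every permutation-group-membership term gate on `≤ m^c` points, fed with clique atoms of `≤ lOf m`
vertices, is `epsOf c m`-approximated by a small-clique DNF, one-sidedly on the referee pair (bare `kOf m`-cliques,
`G(m, qOf m)`) (definitions: `…Theorems.ConvexRankGatesLinAlgGateBlindDefs`). This file proves the stub for every
gate class `PERM_d` whose SUBGROUP LATTICE IS SMALL, at every level `c`:

* `sgAt_perm_of_cover_budget` — the non-asymptotic form: the maxterm cover of a `PERM_d` term gate by the all-off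
  events of the subgroups `K ∌ τ` of its permutation data (re-derived inside the proof; it is the lemma
  `isTermGate_perm_eq_false_iff` of `…Theorems.ConvexRankGatesLinAlgGateBlindSGPermLocality`, which is not imported
  here) has `≤ #Sub(Sym(d))` members (`card_subgroup_perm_mono`), so the planting theorem `sg_of_maxtermCover`
  (`…Theorems.ConvexRankGatesLinAlgGateBlindPlanting`) with `η = ε/#𝒱(l)` gives `SGAt m (IsPermGate d) l k q ε` as
  soon as `(ν·C(l,2))^t·C(m-t,k-t) ≤ ε·C(m,k)` and `#Sub(Sym(d))·(1/2)^{ν+1}·#𝒱(l) < ε`;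
* `sgAt_perm_of_fewSubgroups` — for every `c`, eventually in `m`, for every `d` with `log₂ #Sub(Sym(d)) ≤ m^{3/4}/2`:
  `SGAt m (IsPermGate d) (lOf m) (kOf m) (qOf m) (epsOf c m)` (the budgets at `ν = ⌈m^{3/4}⌉₊`, `t = ⌊lOf m/2⌋` are
  `permSmallDim_budgets`, `…Theorems.ConvexRankGatesLinAlgGateBlindPermSmallDimAux`; the dense-regime facts
  `0 ≤ q ≤ 1`, `q^{C(l,2)} ≥ 1/2` are `stub_denseRegime`);
* `sgAt_perm_of_dim_le` — the explicit range `d²(log₂ d + 1)² ≤ m^{3/4}/2` (all `d ≤ m^{3/8 - o(1)}`), by the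
  subgroup count `#Sub(G) ≤ (|G| + 1)^{⌊log₂ |G|⌋}` (`Hallgren2005.card_subgroup_le`) and `d! ≤ d^d`
  (`logb_card_subgroup_perm_le`).

In the stub's own coupling `d = m^c` this settles `c = 0` outright and shows that a violator of `stub_sgPerm` needs a
rejection event of entropy `> m^{3/4}/2` (report of stub `stub_sgPerm`, §1). Sources: Alon–Boppana 1987 §3,
Razborov 1985 (approximation method); the planting argument is the tree's. [folklore]
-/

-- `Summit.PneNP.PneNP.…` duplicates `PneNP` BY DESIGN (single-problem summit).
set_option linter.dupNamespace false

noncomputable section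

namespace Summit.PneNP.PneNP.Cruxes.LinAlgGateBlind.DnfInvariantWideGatesSeeSmallCliques

open scoped BigOperators
open Finset Filter Literature.Computability.Complexity Razborov

/-! ### Monotonicity of the subgroup count of `Sym(d)` in `d` -/

/-- `Sym(d')` embeds into `Sym(d)` for `d' ≤ d` (`Equiv.Perm.viaEmbeddingHom` along `Fin.castLEEmb`), and pushing
subgroups forward along an injective homomorphism is injective; so `#Sub(Sym(d')) ≤ #Sub(Sym(d))`. [folklore] -/
theorem card_subgroup_perm_mono {d' d : ℕ} (h : d' ≤ d) :
    Nat.card (Subgroup (Equiv.Perm (Fin d'))) ≤ Nat.card (Subgroup (Equiv.Perm (Fin d))) :=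
  Nat.card_le_card_of_injective _
    (Subgroup.map_injective (Equiv.Perm.viaEmbeddingHom_injective (Fin.castLEEmb h)))

/-! ### SG_PERM from the two budgets of the planting theorem -/

/-- **SG_PERM from a cover budget (non-asymptotic corollary of the planting theorem).** Let `q ∈ [0,1]`,
`1 - q^{C(l,2)} ≤ 1/2`, `0 < ε`, `2t ≤ l`, and suppose the POSITIVE budget
`(ν·C(l,2))^t · C(m-t, k-t) ≤ ε·C(m,k)` and the FRAGILITY budget `#Sub(Sym(d)) · (1/2)^{ν+1} · #𝒱(l) < ε`. Then
`SGAt m (IsPermGate d) l k q ε`: a term gate `O` of class `PERM_d` over `≤ l`-atoms has permutation data on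
`d' ≤ d` points, and its rejection region is covered by the all-off events `D_K = {all atoms X_a with σ_a ∉ K off}`,
`K` a subgroup with `τ ∉ K` (`O x = 0` iff `τ ∉ ⟨σ_a : X_a present⟩`; take `K` = that closure, conversely a `K ∌ τ`
containing all present generators contains the closure — cf. `isTermGate_perm_eq_false_iff`), each inside the
rejection region; there are
`N ≤ #Sub(Sym(d')) ≤ #Sub(Sym(d))` of them (`card_subgroup_perm_mono`), so the planting theorem `sg_of_maxtermCover`
with `η = ε/#𝒱(l)` yields a small-clique DNF with `#lostPos ≤ ε·C(m,k)` and `gainedNeg ≤ #𝒱(l)·η = ε`. [folklore] -/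
theorem sgAt_perm_of_cover_budget : ∀ (m l k d ν t : ℕ) (q ε : ℝ), 0 ≤ q → q ≤ 1 → 1 - q ^ (l.choose 2) ≤ 1 / 2 → 0 < ε → 2 * t ≤ l → (((ν * l.choose 2) ^ t * (m - t).choose (k - t) : ℕ) : ℝ) ≤ ε * (m.choose k : ℝ) → (Nat.card (Subgroup (Equiv.Perm (Fin d))) : ℝ) * (1 / 2) ^ (ν + 1) * #(smallSets (Fin m) l) < ε → SGAt m (IsPermGate d) l k q ε := by
  intro m l k d ν t q ε hq0 hq1 hql hε htl hpos hfrag O hO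
  classical
  obtain ⟨g, ⟨d', hd', σ, τ, hg⟩, X, hX, hOX⟩ := hO
  -- the maxterm cover of a PERM term gate (cf. `isTermGate_perm_eq_false_iff`, module `…SGPermLocality`): `O x = 0` iff
  -- some subgroup `K ∌ τ` contains every generator `σ a` whose atom `X a` is present in `x`
  have hiff : ∀ x, O x = false ↔
      ∃ K : Subgroup (Equiv.Perm (Fin d')), τ ∉ K ∧ ∀ a, σ a ∉ K → ¬ CliquePresent (X a) x := by
    intro x
    have hS : ∀ K : Subgroup (Equiv.Perm (Fin d')),
        σ '' {i | (fun a => atomB (X a) x) i = true} ⊆ K ↔ ∀ a, σ a ∉ K → ¬ CliquePresent (X a) x := by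
      intro K
      rw [Set.image_subset_iff]
      refine forall_congr' fun a => ?_
      simp only [Set.mem_setOf_eq, Set.mem_preimage, atomB, decide_eq_true_eq, SetLike.mem_coe]
      exact ⟨fun h hK hP => hK (h hP), fun h hP => by_contra fun hK => h hK hP⟩
    rw [hOX x]
    constructor
    · intro h0
      refine ⟨Subgroup.closure (σ '' {i | (fun a => atomB (X a) x) i = true}), fun hτ => ?_,
        (hS _).1 Subgroup.subset_closure⟩
      rw [(hg _).2 hτ] at h0
      exact Bool.noConfusion h0
    · rintro ⟨K, hτK, hK⟩
      rcases hv : g.2 (fun a => atomB (X a) x) with _ | _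
      · rfl
      · exact absurd ((Subgroup.closure_le K).2 ((hS K).2 hK) ((hg _).1 hv)) hτK
  -- index the maxterm cover by the subgroups avoiding `τ`
  have hV : (0 : ℝ) < #(smallSets (Fin m) l) := Nat.cast_pos.2 (card_pos.2 ⟨∅, empty_mem_smallSets l⟩)
  set J := {K : Subgroup (Equiv.Perm (Fin d')) // τ ∉ K} with hJ
  set N := Nat.card J with hNdef
  set e : J ≃ Fin N := Finite.equivFin J with he
  set 𝓛 : Fin N → Finset (Finset (Fin m)) := fun j => (univ.filter fun a => σ a ∉ (e.symm j).1).image X with h𝓛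
  have hNle : (N : ℝ) ≤ Nat.card (Subgroup (Equiv.Perm (Fin d))) := by
    exact_mod_cast (Nat.card_le_card_of_injective (Subtype.val : J → Subgroup (Equiv.Perm (Fin d')))
      Subtype.val_injective).trans (card_subgroup_perm_mono hd')
  have hN : (N : ℝ) * (1 / 2) ^ (ν + 1) < ε / #(smallSets (Fin m) l) := by
    rw [lt_div_iff₀ hV]
    calc (N : ℝ) * (1 / 2) ^ (ν + 1) * #(smallSets (Fin m) l)
        ≤ Nat.card (Subgroup (Equiv.Perm (Fin d))) * (1 / 2) ^ (ν + 1) * #(smallSets (Fin m) l) := by gcongr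
      _ < ε := hfrag
  have h1 : ∀ j, 𝓛 j ⊆ smallSets (Fin m) l := by
    intro j Y hY
    obtain ⟨a, -, rfl⟩ := mem_image.1 hY
    exact hX a
  have h2 : ∀ x, O x = false → ∃ j, ∀ Y ∈ 𝓛 j, ¬ CliquePresent Y x := by
    intro x hx
    obtain ⟨K, hτK, hK⟩ := (hiff x).1 hx
    refine ⟨e ⟨K, hτK⟩, fun Y hY => ?_⟩
    obtain ⟨a, ha, rfl⟩ := mem_image.1 hY
    rw [mem_filter, Equiv.symm_apply_apply] at ha
    exact hK a ha.2
  have h3 : ∀ j x, (∀ Y ∈ 𝓛 j, ¬ CliquePresent Y x) → O x = false := fun j x hall =>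
    (hiff x).2 ⟨(e.symm j).1, (e.symm j).2, fun a ha =>
      hall (X a) (mem_image_of_mem X (mem_filter.2 ⟨mem_univ a, ha⟩))⟩
  obtain ⟨𝒜, h𝒜, hP, hNg⟩ := sg_of_maxtermCover m l k N ν t q (ε / #(smallSets (Fin m) l)) O 𝓛 h1 h2 h3
    hq0 hq1 hql (div_pos hε hV) hN htl
  refine ⟨𝒜, h𝒜, ?_, hNg.trans_eq (mul_div_cancel₀ ε hV.ne')⟩
  calc (#(lostPos m k O 𝒜) : ℝ) ≤ (((ν * l.choose 2) ^ t * (m - t).choose (k - t) : ℕ) : ℝ) := by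
        exact_mod_cast hP
    _ ≤ ε * (m.choose k : ℝ) := hpos

/-! ### SG_PERM for permutation gates with few subgroups, at the parameters of the line -/

open DenseRegime in
/-- **SG_PERM for gates with a small subgroup lattice (corollary of the planting theorem; a sub-range of the
research stub `stub_sgPerm`).** For every `c`, eventually in `m`: for every `d` with
`log₂ #Sub(Sym(d)) ≤ m^{3/4}/2`, the single-gate statement `SGAt m (IsPermGate d) (lOf m) (kOf m) (qOf m) (epsOf c m)`
of the line holds — every `PERM_d` term gate over `≤ lOf m`-atoms is `epsOf c m`-approximated, one-sidedly on
(bare `kOf m`-cliques, `G(m, qOf m)`), by a small-clique DNF. Since `#Sub(Sym(d)) ≤ (d! + 1)^{⌊log₂ d!⌋}`, this covers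
all `d ≤ m^{3/8 - o(1)}`. Proof: `sgAt_perm_of_cover_budget` with `ν = ⌈m^{3/4}⌉₊`, `t = ⌊l/2⌋`, the dense-regime
facts `0 ≤ q ≤ 1`, `q^{C(l,2)} ≥ 1/2` (`stub_denseRegime`) and the two budgets `permSmallDim_budgets`
(`#Sub(Sym(d)) ≤ 2^{m^{3/4}/2}` by `Real.logb_le_iff_le_rpow`). [folklore] -/
theorem sgAt_perm_of_fewSubgroups : ∀ c : ℕ, ∀ᶠ m : ℕ in atTop, ∀ d : ℕ, Real.logb 2 (Nat.card (Subgroup (Equiv.Perm (Fin d)))) ≤ (m : ℝ) ^ (3 / 4 : ℝ) / 2 → SGAt m (IsPermGate d) (lOf m) (kOf m) (qOf m) (epsOf c m) := by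
  intro c
  filter_upwards [stub_denseRegime c, permSmallDim_budgets c, eventually_ge_atTop 1] with m hD hB hm d hd
  obtain ⟨-, -, -, hq0, hq1, -, -, -, -, hhalf⟩ := hD
  obtain ⟨hpos, hfrag⟩ := hB
  have hmpos : (0 : ℝ) < m := by exact_mod_cast hm
  have hε : 0 < epsOf c m := by
    rw [epsOf_eq]
    positivity
  have hN : (Nat.card (Subgroup (Equiv.Perm (Fin d))) : ℝ) ≤ (2 : ℝ) ^ ((m : ℝ) ^ (3 / 4 : ℝ) / 2) :=
    (Real.logb_le_iff_le_rpow one_lt_two (Nat.cast_pos.2 Nat.card_pos)).1 hd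
  refine sgAt_perm_of_cover_budget m (lOf m) (kOf m) d ⌈(m : ℝ) ^ (3 / 4 : ℝ)⌉₊ (lOf m / 2)
    (qOf m) (epsOf c m) hq0 hq1 (by linarith) hε (Nat.mul_div_le (lOf m) 2) hpos ?_
  calc (Nat.card (Subgroup (Equiv.Perm (Fin d))) : ℝ) * (1 / 2) ^ (⌈(m : ℝ) ^ (3 / 4 : ℝ)⌉₊ + 1) *
        #(smallSets (Fin m) (lOf m))
      ≤ (2 : ℝ) ^ ((m : ℝ) ^ (3 / 4 : ℝ) / 2) * (1 / 2) ^ (⌈(m : ℝ) ^ (3 / 4 : ℝ)⌉₊ + 1) *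
        #(smallSets (Fin m) (lOf m)) := by gcongr
    _ < epsOf c m := hfrag

/-! ### An explicit range: `d² (log₂ d + 1)² ≤ m^{3/4}/2` -/

open DenseRegime in
/-- **Counting subgroups of `Sym(d)`.** `log₂ #Sub(Sym(d)) ≤ d²(log₂ d + 1)²`: every subgroup of a finite group `G` is
generated by `≤ log₂ |G|` elements (a new generator at least doubles the order), so `#Sub(G) ≤ (|G| + 1)^{⌊log₂ |G|⌋}`
(`Hallgren2005.card_subgroup_le`); for `G = Sym(d)`, `|G| = d! ≤ d^d`, hence
`log₂ #Sub ≤ log₂(d!) · log₂(d! + 1) ≤ d log₂ d · (1 + d log₂ d) ≤ d²(log₂ d + 1)²`. [folklore] -/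
theorem logb_card_subgroup_perm_le (d : ℕ) :
    Real.logb 2 (Nat.card (Subgroup (Equiv.Perm (Fin d)))) ≤ (d : ℝ) ^ 2 * (Real.logb 2 d + 1) ^ 2 := by
  have hcard : Nat.card (Equiv.Perm (Fin d)) = d.factorial := by
    rw [Nat.card_perm, Nat.card_eq_fintype_card, Fintype.card_fin]
  have hH := Literature.Computability.Cryptography.Hallgren2005.card_subgroup_le (G := Equiv.Perm (Fin d))
  rw [hcard] at hH
  set L := Nat.log 2 d.factorial with hL
  have hfact : (0 : ℝ) < (d.factorial : ℝ) := by exact_mod_cast Nat.factorial_pos d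
  have hfact1 : (1 : ℝ) ≤ (d.factorial : ℝ) := by exact_mod_cast Nat.factorial_pos d
  have hN : (0 : ℝ) < (Nat.card (Subgroup (Equiv.Perm (Fin d))) : ℝ) := Nat.cast_pos.2 Nat.card_pos
  -- `log₂ #Sub ≤ L · log₂(d! + 1)`
  have h1 : Real.logb 2 (Nat.card (Subgroup (Equiv.Perm (Fin d)))) ≤ (L : ℝ) * Real.logb 2 ((d.factorial : ℝ) + 1) := by
    have h := Real.logb_le_logb_of_le one_lt_two hN
      (show (Nat.card (Subgroup (Equiv.Perm (Fin d))) : ℝ) ≤ (((d.factorial + 1) ^ L : ℕ) : ℝ) by exact_mod_cast hH)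
    rw [Nat.cast_pow, Real.logb_pow] at h
    push_cast at h
    exact h
  have hlogd : 0 ≤ Real.logb 2 d := logb_two_nonneg d
  have hd0 : (0 : ℝ) ≤ d := Nat.cast_nonneg d
  -- `log₂(d!) ≤ d log₂ d`
  have h2 : Real.logb 2 (d.factorial : ℝ) ≤ d * Real.logb 2 d := by
    rcases Nat.eq_zero_or_pos d with rfl | hd
    · simp
    · calc Real.logb 2 (d.factorial : ℝ) ≤ Real.logb 2 ((d : ℝ) ^ d) :=
            Real.logb_le_logb_of_le one_lt_two hfact (by exact_mod_cast Nat.factorial_le_pow d)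
        _ = d * Real.logb 2 d := Real.logb_pow _ _ _
  -- `L ≤ log₂(d!)`
  have h3 : (L : ℝ) ≤ Real.logb 2 (d.factorial : ℝ) := by
    have := Real.natLog_le_logb d.factorial 2
    push_cast at this
    exact this
  -- `log₂(d! + 1) ≤ 1 + log₂(d!)`
  have h4 : Real.logb 2 ((d.factorial : ℝ) + 1) ≤ 1 + Real.logb 2 (d.factorial : ℝ) :=
    calc Real.logb 2 ((d.factorial : ℝ) + 1) ≤ Real.logb 2 (2 * d.factorial) :=
          Real.logb_le_logb_of_le one_lt_two (by positivity) (by linarith)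
      _ = Real.logb 2 2 + Real.logb 2 (d.factorial : ℝ) := Real.logb_mul (by norm_num) hfact.ne'
      _ = 1 + Real.logb 2 (d.factorial : ℝ) := by rw [Real.logb_self_eq_one one_lt_two]
  set a := (d : ℝ) * Real.logb 2 d with ha
  have ha0 : 0 ≤ a := mul_nonneg hd0 hlogd
  calc Real.logb 2 (Nat.card (Subgroup (Equiv.Perm (Fin d))))
      ≤ (L : ℝ) * Real.logb 2 ((d.factorial : ℝ) + 1) := h1
    _ ≤ a * (1 + a) :=
        mul_le_mul (h3.trans h2) (h4.trans (by linarith)) (Real.logb_nonneg one_lt_two (by linarith))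
          ha0
    _ ≤ (d : ℝ) ^ 2 * (Real.logb 2 d + 1) ^ 2 := by
        rcases Nat.eq_zero_or_pos d with hd | hd
        · subst hd
          simp [ha]
        · have hd1 : (1 : ℝ) ≤ d := by exact_mod_cast hd
          have hsq : (d : ℝ) ^ 2 * (Real.logb 2 d + 1) ^ 2 = (a + d) ^ 2 := by rw [ha]; ring
          rw [hsq]
          nlinarith [mul_nonneg ha0 (show (0 : ℝ) ≤ 2 * d - 1 by linarith)]

/-- **SG_PERM for all `PERM_d` gates with `d²(log₂ d + 1)² ≤ m^{3/4}/2`** (so for all `d ≤ m^{3/8 - o(1)}`), at every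
level `c`, eventually in `m`: `sgAt_perm_of_fewSubgroups` and the subgroup count `logb_card_subgroup_perm_le`.
[folklore] -/
theorem sgAt_perm_of_dim_le : ∀ c : ℕ, ∀ᶠ m : ℕ in atTop, ∀ d : ℕ, (d : ℝ) ^ 2 * (Real.logb 2 d + 1) ^ 2 ≤ (m : ℝ) ^ (3 / 4 : ℝ) / 2 → SGAt m (IsPermGate d) (lOf m) (kOf m) (qOf m) (epsOf c m) := by
  intro c
  filter_upwards [sgAt_perm_of_fewSubgroups c] with m hm d hd
  exact hm d ((logb_card_subgroup_perm_le d).trans hd)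

end Summit.PneNP.PneNP.Cruxes.LinAlgGateBlind.DnfInvariantWideGatesSeeSmallCliques

end
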